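import Summits.QuantumFields.BalabanUV.Beta.RowD1AuxiliaryExchange

/-!
# `RowD1SchemeDefect` — the SCHEME DEFECT «Δ_scheme(m) bounded in m» of row D1 as a TYPED STATEMENT, and its exact place among the
# row's open clauses (owner RULINGS R-D1-g22-9 ∕ R-D1-g22-10; an3's scoping memo `JCCOMP-SCOPE.v1.md`), v1

HONEST FRAMING (page 1, mandatory).  β sub-cell of the Bałaban audit; END STATEMENT: discharging the one-loop hypothesis `FlowStep.BetaPertH`
makes Bałaban's ultraviolet stability theorem UNCONDITIONAL — NOT the continuum limit, NOT Clay.  THIS FILE DISCHARGES NOTHING.  It names ONE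
`Prop` and proves bookkeeping about it from theorems already in the tree; every analytic clause stays a HYPOTHESIS.  Row-D1 END of record:
`RowD1TelescopingBounded.d1Drift_JsRowD1Pin_of_sdSumBdd_D1Rep` consuming (SDF-Σ) for `(JsRowD1Pin hLc N, JcPin hLc N)`; binders 2∕4.
HONEST DEPENDENCY: continuum YM on T⁴ ⇐ BetaPertH ∧ nine spine estimates (0∕9 proved); BetaPertH ⇐ (D1) ∧ (D4) ∧ CAP+tail; G-an2-4 gates asym,
D1 and NE2∕3∕4.

WHAT.  For two one-shot jet families `Jc Jc′ : ∀ m, JetData 3 (Lc^m)` the SCHEME DEFECT at scale `Lc^m` is the difference of the `(μ, ν)` second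
moments of their one-shot kernels `TshotOf Lc Jc m`, `TshotOf Lc Jc′ m` (`OneStepKernelFamily.TshotOf`); `SchemeDefectBdd Lc Jc Jc′ μ ν` says it is
bounded uniformly in `m ≥ 1`.  At the literal of record the first family is the pinned straight one-shot family `D1BFx.FirstStepPinned.JcPin hLc N`
and the second is ANY comparison family `Jc′` — the intended instance being the COMPOSITE family `JcComp` of the scoping memo (m-fold composite
averaging tables; NOT typed in the tree, so nothing here mentions it).  CONTENT: `SchemeDefectBdd` is reflexive ∕ symmetric ∕ transitive (so a
defect may be split through an intermediate family — e.g. «dressing part» + «table part»); (i) GIVEN the LAYER-2 data of `Jc′` (one-shot Ward sums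
(T0)∕(T1), base identity, (SDF-Σ) against the literal `JsRowD1Pin hLc N`), `SchemeDefectBdd … (JcPin hLc N) Jc′ ↔ (SDF-Σ)(JsRowD1Pin, JcPin)`
(`schemeDefectBdd_iff_sdSumBdd`, from an3's exchange socket `RowD1AuxiliaryExchange.sdSumBdd_JsRowD1Pin_JcPin_of_exchange` and its converse
`schemeDefectBdd_JcPin_of_sdSumBdd_pair`); (ii) GIVEN moreover `D1Rep Lc (JcPin hLc N) …` and the standing free-bubble data,
`SchemeDefectBdd … ↔ D1Drift Lc (JsRowD1Pin hLc N) Nc μ ν` (`schemeDefectBdd_iff_d1Drift_of_D1Rep`, through the owner's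
`RowD1TelescopingBounded.sdSumBdd_iff_D1Drift_of_D1Rep`).  So, HONESTLY: given LAYER 2 for the comparison family and `D1Rep(JcPin)`, the scheme
defect is NOT smaller than the END — it IS the END's remaining analytic content, relocated into a comparison of two explicit one-shot kernels
at the same blocking with no step recursion in the statement (owner R-D1-g22-10: «Δ_scheme(m) bounded in m», OPEN).  0 cited facts; the
printed B5 facts enter (ii) BY NAME as hypotheses exactly as in the files imported; NOT D1, NOT `BetaPertH`, NOT continuum, NOT Clay.
-/

open Finset
open scoped BigOperators
open Literature.MathematicalPhysics.QuantumFieldTheory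
open Literature.MathematicalPhysics.QuantumFieldTheory.Balaban1983to89
open Literature.MathematicalPhysics.QuantumFieldTheory.Balaban1983to89.Beta
open OneStepResolventKernel (JetData)
open OneStepKernelFamily (TbalOf TshotOf D1Rep D1Drift)
open StepDriftWitness (SD SDInvisible)
open B12Beta (secondMoment)
open Literature.MathematicalPhysics.QuantumFieldTheory.Balaban1983to89.Beta.VectorTailsLoc (fam kfam)
open Literature.MathematicalPhysics.QuantumFieldTheory.Balaban1983to89.Beta.VectorLegVolumeAdapter (MvE)
open Summit.QuantumFields.BalabanUV.Beta.RowD1JointEnd (JsRowD1Pin)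
open Summit.QuantumFields.BalabanUV.Beta.D1BFx.FirstStepPinned (JcPin)
open Summit.QuantumFields.BalabanUV.Beta.RowD1TelescopingBounded (sdSumBdd_iff_D1Drift_of_D1Rep)
open Summit.QuantumFields.BalabanUV.Beta.RowD1AuxiliaryExchange (sdSumBdd_JsRowD1Pin_JcPin_of_exchange schemeDefectBdd_JcPin_of_sdSumBdd_pair)

noncomputable section

namespace Summit.QuantumFields.BalabanUV.Beta.RowD1SchemeDefect

variable {Lc : ℕ} [NeZero Lc] {L : Type*}

/-- [folklore] **THE SCHEME DEFECT IS BOUNDED**: the `(μ, ν)` second moments of the one-shot kernels of two one-shot jet families `Jc`, `Jc′` differ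
by a constant uniformly in the scale `Lc^m`, `m ≥ 1` (owner R-D1-g22-10's «Δ_scheme(m) bounded in m» when `Jc = JcPin hLc N` and `Jc′` is the composite
family). -/
def SchemeDefectBdd (Lc : ℕ) [NeZero Lc] (Jc Jc' : ∀ m : ℕ, JetData 3 (Lc ^ m)) (μ ν : Fin 4) : Prop :=
  ∃ B : ℝ, ∀ m : ℕ, 1 ≤ m → |secondMoment (TshotOf Lc Jc m) μ ν - secondMoment (TshotOf Lc Jc' m) μ ν| ≤ B

/-- [folklore] Unfolding lemma. -/
theorem schemeDefectBdd_iff (Jc Jc' : ∀ m : ℕ, JetData 3 (Lc ^ m)) (μ ν : Fin 4) :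
    SchemeDefectBdd Lc Jc Jc' μ ν ↔
      ∃ B : ℝ, ∀ m : ℕ, 1 ≤ m → |secondMoment (TshotOf Lc Jc m) μ ν - secondMoment (TshotOf Lc Jc' m) μ ν| ≤ B := Iff.rfl

/-- [folklore] Reflexivity (constant `0`). -/
theorem schemeDefectBdd_refl (Jc : ∀ m : ℕ, JetData 3 (Lc ^ m)) (μ ν : Fin 4) : SchemeDefectBdd Lc Jc Jc μ ν :=
  ⟨0, fun m _ => by rw [sub_self, abs_zero]⟩

/-- [folklore] Symmetry (same constant). -/
theorem schemeDefectBdd_symm {Jc Jc' : ∀ m : ℕ, JetData 3 (Lc ^ m)} {μ ν : Fin 4} (h : SchemeDefectBdd Lc Jc Jc' μ ν) :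
    SchemeDefectBdd Lc Jc' Jc μ ν := by
  obtain ⟨B, hB⟩ := h
  exact ⟨B, fun m hm => by rw [abs_sub_comm]; exact hB m hm⟩

/-- [folklore] **TRANSITIVITY** (constants add): a scheme defect may be split through an intermediate family — the route «dressing part + table part»
of the scoping memo (`JcPin` → big-block-dressed composite tables → composite-dressed composite tables). -/
theorem schemeDefectBdd_trans {Jc Jc' Jc'' : ∀ m : ℕ, JetData 3 (Lc ^ m)} {μ ν : Fin 4} (h : SchemeDefectBdd Lc Jc Jc' μ ν)
    (h' : SchemeDefectBdd Lc Jc' Jc'' μ ν) : SchemeDefectBdd Lc Jc Jc'' μ ν := by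
  obtain ⟨B, hB⟩ := h
  obtain ⟨B', hB'⟩ := h'
  exact ⟨B + B', fun m hm => (abs_sub_le _ _ _).trans (add_le_add (hB m hm) (hB' m hm))⟩

/-! ## At the literal of record: the scheme defect against `JcPin hLc N` among the row's open clauses -/

/-- [folklore] **(SDF-Σ) FOR THE PAIR OF RECORD FROM LAYER 2 OF A COMPARISON FAMILY + BOUNDED SCHEME DEFECT** — an3's exchange socket
`sdSumBdd_JsRowD1Pin_JcPin_of_exchange` with the defect hypothesis spelled `SchemeDefectBdd`.  Nothing about `Jc′` is asserted. -/
theorem sdSumBdd_JcPin_of_schemeDefectBdd (hLc : Odd Lc) {N : ℕ} (hN : 2 ≤ N) (Jc' : ∀ m : ℕ, JetData 3 (Lc ^ m)) (μ ν : Fin 4)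
    (h𝒯0' : ∀ m, 1 ≤ m → ∀ c e : Fin 4, HasSum (TshotOf Lc Jc' m c e) 0)
    (h𝒯1' : ∀ m, 1 ≤ m → ∀ c e ρ : Fin 4, HasSum (fun t : Fin 4 → ℤ => t ρ • TshotOf Lc Jc' m c e t) 0)
    (hbase' : TshotOf Lc Jc' 1 = TbalOf Lc (JsRowD1Pin hLc N) 0)
    (hSB' : ∃ U' : ℝ, ∀ m : ℕ, 1 ≤ m → |∑ j ∈ Ico 1 m, secondMoment (SD Lc (JsRowD1Pin hLc N) Jc' j) μ ν| ≤ U')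
    (hΔ : SchemeDefectBdd Lc (JcPin hLc N) Jc' μ ν) :
    ∃ U : ℝ, ∀ m : ℕ, 1 ≤ m → |∑ j ∈ Ico 1 m, secondMoment (SD Lc (JsRowD1Pin hLc N) (JcPin hLc N) j) μ ν| ≤ U :=
  sdSumBdd_JsRowD1Pin_JcPin_of_exchange hLc hN Jc' μ ν h𝒯0' h𝒯1' hbase' hSB' hΔ

/-- [folklore] **GIVEN LAYER 2 OF THE COMPARISON FAMILY, THE BOUNDED SCHEME DEFECT IS EQUIVALENT TO (SDF-Σ) FOR THE PAIR OF RECORD**: the clause the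
row END consumes and «Δ_scheme(m) bounded in m» are then the same statement. -/
theorem schemeDefectBdd_iff_sdSumBdd (hLc : Odd Lc) {N : ℕ} (hN : 2 ≤ N) (Jc' : ∀ m : ℕ, JetData 3 (Lc ^ m)) (μ ν : Fin 4)
    (h𝒯0' : ∀ m, 1 ≤ m → ∀ c e : Fin 4, HasSum (TshotOf Lc Jc' m c e) 0)
    (h𝒯1' : ∀ m, 1 ≤ m → ∀ c e ρ : Fin 4, HasSum (fun t : Fin 4 → ℤ => t ρ • TshotOf Lc Jc' m c e t) 0)
    (hbase' : TshotOf Lc Jc' 1 = TbalOf Lc (JsRowD1Pin hLc N) 0)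
    (hSB' : ∃ U' : ℝ, ∀ m : ℕ, 1 ≤ m → |∑ j ∈ Ico 1 m, secondMoment (SD Lc (JsRowD1Pin hLc N) Jc' j) μ ν| ≤ U') :
    SchemeDefectBdd Lc (JcPin hLc N) Jc' μ ν ↔
      ∃ U : ℝ, ∀ m : ℕ, 1 ≤ m → |∑ j ∈ Ico 1 m, secondMoment (SD Lc (JsRowD1Pin hLc N) (JcPin hLc N) j) μ ν| ≤ U :=
  ⟨sdSumBdd_JcPin_of_schemeDefectBdd hLc hN Jc' μ ν h𝒯0' h𝒯1' hbase' hSB',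
    fun hSB => schemeDefectBdd_JcPin_of_sdSumBdd_pair hLc hN Jc' μ ν h𝒯0' h𝒯1' hbase' hSB hSB'⟩

/-- [folklore] **EXACT-TELESCOPING VARIANT**: with (SDF) `SDInvisible Lc (JsRowD1Pin hLc N) Jc′ μ ν` (every defect increment has vanishing second moment —
the LAYER-2 target for the composite family) in place of (SDF-Σ)(JsRowD1Pin, Jc′). -/
theorem schemeDefectBdd_iff_sdSumBdd_of_sdInvisible (hLc : Odd Lc) {N : ℕ} (hN : 2 ≤ N) (Jc' : ∀ m : ℕ, JetData 3 (Lc ^ m)) (μ ν : Fin 4)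
    (h𝒯0' : ∀ m, 1 ≤ m → ∀ c e : Fin 4, HasSum (TshotOf Lc Jc' m c e) 0)
    (h𝒯1' : ∀ m, 1 ≤ m → ∀ c e ρ : Fin 4, HasSum (fun t : Fin 4 → ℤ => t ρ • TshotOf Lc Jc' m c e t) 0)
    (hbase' : TshotOf Lc Jc' 1 = TbalOf Lc (JsRowD1Pin hLc N) 0)
    (hSF' : SDInvisible Lc (JsRowD1Pin hLc N) Jc' μ ν) :
    SchemeDefectBdd Lc (JcPin hLc N) Jc' μ ν ↔
      ∃ U : ℝ, ∀ m : ℕ, 1 ≤ m → |∑ j ∈ Ico 1 m, secondMoment (SD Lc (JsRowD1Pin hLc N) (JcPin hLc N) j) μ ν| ≤ U :=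
  schemeDefectBdd_iff_sdSumBdd hLc hN Jc' μ ν h𝒯0' h𝒯1' hbase'
    ⟨0, fun m _ => by rw [Finset.sum_eq_zero fun j hj => hSF' j (Finset.mem_Ico.1 hj).1, abs_zero]⟩

/-- [folklore] **GIVEN LAYER 2 OF THE COMPARISON FAMILY AND `D1Rep(JcPin)`, THE BOUNDED SCHEME DEFECT IS EQUIVALENT TO THE ROW'S `D1Drift`** (+ the printed
B5 facts `Prop12Printed`∕`Kernel126_127Printed` BY NAME, window data, `μ ≠ ν`, `Nc ≠ 0`, `2 ≤ Lc`, `2 ≤ N`) — HONEST SIZE of the scheme defect: under these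
hypotheses it is exactly the END's remaining content, neither more nor less.  CONDITIONAL on exactly those; NOT D1, NOT `BetaPertH`, NOT continuum, NOT Clay. -/
theorem schemeDefectBdd_iff_d1Drift_of_D1Rep (hLc : Odd Lc) (hL2 : 2 ≤ Lc) {N : ℕ} (hN : 2 ≤ N)
    (a : ℝ) (ha : 0 < a)
    (h12 : B5.Prop12Printed (fam (fun i : ℕ+ × ℕ => ((i.1 : ℕ+) : ℕ)) (fun i => i.1.pos) MvE a ha))
    (h126 : B5.Kernel126_127Printed (kfam (fun i : ℕ+ × ℕ => ((i.1 : ℕ+) : ℕ)) MvE))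
    {SL : Finset L} (hSL : SL.Nonempty) (k : L → Fin 4) {μ ν : Fin 4} (hμν : μ ≠ ν) {Nc : ℝ} (hNc : Nc ≠ 0)
    (Jc' : ∀ m : ℕ, JetData 3 (Lc ^ m))
    (h𝒯0' : ∀ m, 1 ≤ m → ∀ c e : Fin 4, HasSum (TshotOf Lc Jc' m c e) 0)
    (h𝒯1' : ∀ m, 1 ≤ m → ∀ c e ρ : Fin 4, HasSum (fun t : Fin 4 → ℤ => t ρ • TshotOf Lc Jc' m c e t) 0)
    (hbase' : TshotOf Lc Jc' 1 = TbalOf Lc (JsRowD1Pin hLc N) 0)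
    (hSB' : ∃ U' : ℝ, ∀ m : ℕ, 1 ≤ m → |∑ j ∈ Ico 1 m, secondMoment (SD Lc (JsRowD1Pin hLc N) Jc' j) μ ν| ≤ U')
    {cc : ℝ} {M : ℕ → ℕ} (hc : 1 ≤ cc) (hMw : ∀ L : ℕ, 2 ≤ L → 1 ≤ M L ∧ (L : ℝ) ≤ cc * M L) (hML : ∀ L : ℕ, 2 ≤ L → M L ≤ L)
    (hrep : D1Rep Lc (JcPin hLc N) Nc μ ν a SL k) :
    SchemeDefectBdd Lc (JcPin hLc N) Jc' μ ν ↔ D1Drift Lc (JsRowD1Pin hLc N) Nc μ ν :=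
  (schemeDefectBdd_iff_sdSumBdd hLc hN Jc' μ ν h𝒯0' h𝒯1' hbase' hSB').trans
    (sdSumBdd_iff_D1Drift_of_D1Rep hLc hL2 hN a ha h12 h126 hSL k hμν hNc hc hMw hML hrep)

/-- [folklore] **THE ROW END THROUGH THE SCHEME DEFECT** (forward direction of the previous lemma, packaged): LAYER 2 of a comparison family ∧
`SchemeDefectBdd Lc (JcPin hLc N) Jc′ μ ν` ∧ `D1Rep(JcPin)` (+ standing data) ⟹ `D1Drift Lc (JsRowD1Pin hLc N) Nc μ ν`.  CONDITIONAL on exactly those. -/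
theorem d1Drift_JsRowD1Pin_of_schemeDefectBdd_D1Rep (hLc : Odd Lc) (hL2 : 2 ≤ Lc) {N : ℕ} (hN : 2 ≤ N)
    (a : ℝ) (ha : 0 < a)
    (h12 : B5.Prop12Printed (fam (fun i : ℕ+ × ℕ => ((i.1 : ℕ+) : ℕ)) (fun i => i.1.pos) MvE a ha))
    (h126 : B5.Kernel126_127Printed (kfam (fun i : ℕ+ × ℕ => ((i.1 : ℕ+) : ℕ)) MvE))
    {SL : Finset L} (hSL : SL.Nonempty) (k : L → Fin 4) {μ ν : Fin 4} (hμν : μ ≠ ν) {Nc : ℝ} (hNc : Nc ≠ 0)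
    (Jc' : ∀ m : ℕ, JetData 3 (Lc ^ m))
    (h𝒯0' : ∀ m, 1 ≤ m → ∀ c e : Fin 4, HasSum (TshotOf Lc Jc' m c e) 0)
    (h𝒯1' : ∀ m, 1 ≤ m → ∀ c e ρ : Fin 4, HasSum (fun t : Fin 4 → ℤ => t ρ • TshotOf Lc Jc' m c e t) 0)
    (hbase' : TshotOf Lc Jc' 1 = TbalOf Lc (JsRowD1Pin hLc N) 0)
    (hSB' : ∃ U' : ℝ, ∀ m : ℕ, 1 ≤ m → |∑ j ∈ Ico 1 m, secondMoment (SD Lc (JsRowD1Pin hLc N) Jc' j) μ ν| ≤ U')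
    (hΔ : SchemeDefectBdd Lc (JcPin hLc N) Jc' μ ν)
    {cc : ℝ} {M : ℕ → ℕ} (hc : 1 ≤ cc) (hMw : ∀ L : ℕ, 2 ≤ L → 1 ≤ M L ∧ (L : ℝ) ≤ cc * M L) (hML : ∀ L : ℕ, 2 ≤ L → M L ≤ L)
    (hrep : D1Rep Lc (JcPin hLc N) Nc μ ν a SL k) :
    D1Drift Lc (JsRowD1Pin hLc N) Nc μ ν :=
  (schemeDefectBdd_iff_d1Drift_of_D1Rep hLc hL2 hN a ha h12 h126 hSL k hμν hNc Jc' h𝒯0' h𝒯1' hbase' hSB' hc hMw hML hrep).1 hΔ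

end Summit.QuantumFields.BalabanUV.Beta.RowD1SchemeDefect
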